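import Summits.QuantumFields.BalabanUV.Beta.GAN24.DirichletExhaustionCovariancePad

/-!
# `BalabanUV.Beta.GAN24.DirichletExhaustionQuadForm` — binder row G-an2-4 / (CONV-C), part P2, PART 14 = skeleton node S4.a: the QUADRATIC FORM of
# the padded sandwich `pad(CᵀΔC)` on a finite Dirichlet region, as FINITE sums — `⟨v, pad(CᵀΔC)_Λ v⟩ = ⟨Cv, Δ Cv⟩_R + ‖v_nonfree‖²` for a
# finite-range `C` with zero columns off the free set (unit b2b-balaban-gan24-p2, gen 1, v1)

HONEST FRAMING (cell contract, verbatim): «discharging `BetaPertH` makes Bałaban's UV stability UNCONDITIONAL — a real constructive-QFT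
result; it is NOT the continuum limit and NOT the Clay problem.»  Bookkeeping for the coercivity input `CovInputPad.hcoer` (PART 10) of the END
socket: it reduces (in5) for `(elimZ L, deltaZ L, IsFreeZ L)` (PARTS 8/11) to the (2.153)-type lower bound of `Δ_k` on the FINITELY SUPPORTED
constrained field `Cv` (skeleton S3.e) plus `elimZ_iso` (PART 11).  [folklore] finite-sum algebra (`tsum_eq_sum` on the finite support);
nothing printed is used; NOT `BetaPertH`, NOT continuum, NOT Clay.  «not in print; our proof attempt».

ABSOLUTE RULE (cell, verbatim): «No internally-minted statement may enter as a cited fact. Every hypothesis is either kernel-proved in this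
package or a verbatim quotation of a PUBLISHED theorem with page reference. The manuscript(s) under audit are NOT citable for their own disputed
steps — they are the thing under adjudication; programme-internal (2001/route/tribunal) claims are never citable.»

WHAT IS PROVED (0 sorry): `amb` (ambient index of a B4 index), `sandwich_eq_sum` (finite-range `C` ⇒ the pair-`tsum` is a finite double sum),
`mulVec_padOp` (row action of the padded operator), **`quadForm_padOp_sandwich`** (the displayed identity), and its consequence
**`hcoer_of_lower`**: a lower bound `γ·Σ_{r∈R} w_r² ≤ Σ_{r,s∈R} w_r Δ_{rs} w_s` for the image `w = Cv` together with `Σ_{p free} v_p² ≤ Σ_{r∈R} w_r²`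
and `γ ≤ 1` give `CovInputPad.hcoer`'s inequality `γ·Σ v² ≤ ⟨v, pad(CᵀΔC)_Λ v⟩`.  NOT summit progress.
-/

namespace Summit.QuantumFields.BalabanUV.Beta.GAN24.DirichletExhaustionQuadForm

open Finset Real
open Literature.MathematicalPhysics.QuantumFieldTheory.Balaban1983to89
open B4Sect5Exhaustion (K toMat)
open Summit.QuantumFields.BalabanUV.Beta.GAN24.DirichletExhaustionSandwich (sandwich)
open Summit.QuantumFields.BalabanUV.Beta.GAN24.DirichletExhaustionCovariancePad (padOp)

noncomputable section

variable {d N : ℕ}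

/-- The ambient index of a B4 index `p : B4.Idx Λ N`. -/
def amb {Λ : Finset (Fin d → ℤ)} (p : B4.Idx Λ N) : K d N := ((p.1 : Fin d → ℤ), p.2)

/-! ## §1 Finite-range sandwiches are finite double sums -/

/-- If the columns `r ↦ C r p` and `s ↦ C s q` are supported in a finite set `R`, the sandwich entry `(CᵀΔC)(p,q)` is the finite double sum over `R × R`. -/
theorem sandwich_eq_sum (C Δ : K d N → K d N → ℝ) (R : Finset (K d N)) {p q : K d N}
    (hp : ∀ r, C r p ≠ 0 → r ∈ R) (hq : ∀ s, C s q ≠ 0 → s ∈ R) :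
    sandwich C Δ p q = ∑ r ∈ R, ∑ s ∈ R, C r p * Δ r s * C s q := by
  classical
  unfold sandwich
  rw [tsum_eq_sum (s := R ×ˢ R) (fun x hx => ?_), Finset.sum_product]
  rw [Finset.mem_product, not_and_or] at hx
  rcases hx with h | h
  · have : C x.1 p = 0 := by by_contra hne; exact h (hp _ hne)
    rw [this]; ring
  · have : C x.2 q = 0 := by by_contra hne; exact h (hq _ hne)
    rw [this]; ring

/-! ## §2 The row action of the padded operator -/

section Pad

variable {Λ : Finset (Fin d → ℤ)} (Free : K d N → Prop) [DecidablePred Free] (S : K d N → K d N → ℝ)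

/-- Row action of `pad S` on a vector of the finite region: at a FREE row the free columns act through `S`; at a non-free row the pad copies. -/
theorem mulVec_padOp (v : B4.Idx Λ N → ℝ) (p : B4.Idx Λ N) :
    (toMat Λ (padOp Free S)).mulVec v p =
      if Free (amb p) then ∑ q, (if Free (amb q) then S (amb p) (amb q) * v q else 0) else v p := by
  classical
  simp only [Matrix.mulVec, dotProduct, toMat, padOp, amb]
  by_cases hp : Free ((p.1 : Fin d → ℤ), p.2)
  · rw [if_pos hp]
    refine Finset.sum_congr rfl fun q _ => ?_
    by_cases hq : Free ((q.1 : Fin d → ℤ), q.2)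
    · rw [if_pos ⟨hp, hq⟩, if_pos hq]
    · rw [if_neg (fun h => hq h.2), if_neg hq]
      have hne : ((p.1 : Fin d → ℤ), p.2) ≠ ((q.1 : Fin d → ℤ), q.2) := fun h => hq (h ▸ hp)
      rw [if_neg hne, zero_mul]
  · rw [if_neg hp]
    have key : ∀ q : B4.Idx Λ N, (if Free ((p.1 : Fin d → ℤ), p.2) ∧ Free ((q.1 : Fin d → ℤ), q.2) then S ((p.1 : Fin d → ℤ), p.2) ((q.1 : Fin d → ℤ), q.2)
        else if ((p.1 : Fin d → ℤ), p.2) = ((q.1 : Fin d → ℤ), q.2) then (1 : ℝ) else 0) * v q = if p = q then v p else 0 := by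
      intro q
      rw [if_neg (fun h => hp h.1)]
      by_cases hpq : p = q
      · subst hpq; simp
      · have hne : ((p.1 : Fin d → ℤ), p.2) ≠ ((q.1 : Fin d → ℤ), q.2) := by
          intro h; apply hpq
          exact Prod.ext (Subtype.ext (Prod.ext_iff.1 h).1) (Prod.ext_iff.1 h).2
        rw [if_neg hne, if_neg hpq, zero_mul]
    simp_rw [key]
    rw [Finset.sum_ite_eq]; simp

end Pad

/-! ## §3 The quadratic form identity and the coercivity reduction -/

section QuadForm

variable {Λ : Finset (Fin d → ℤ)} (Free : K d N → Prop) [DecidablePred Free] (C Δ : K d N → K d N → ℝ) (R : Finset (K d N))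

/-- **S4.a — THE QUADRATIC FORM OF THE PADDED SANDWICH AS FINITE SUMS.**  For `C` with zero columns off `Free` and columns (over the region) supported in
a finite `R`: `Σ_p v_p (pad(CᵀΔC))_Λ v)_p = Σ_{r,s∈R} w_r Δ_{rs} w_s + Σ_{p non-free} v_p²`, `w_r = Σ_p C r p̂ v_p` (`= (Cv)_r`). -/
theorem quadForm_padOp_sandwich (hC0 : ∀ r p, ¬ Free p → C r p = 0) (hR : ∀ r (p : B4.Idx Λ N), C r (amb p) ≠ 0 → r ∈ R)
    (v : B4.Idx Λ N → ℝ) :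
    ∑ p, v p * (toMat Λ (padOp Free (sandwich C Δ))).mulVec v p =
      (∑ r ∈ R, ∑ s ∈ R, (∑ p, C r (amb p) * v p) * Δ r s * (∑ q, C s (amb q) * v q)) +
        ∑ p, (if Free (amb p) then 0 else v p ^ 2) := by
  classical
  -- row action
  have hrow : ∀ p : B4.Idx Λ N, v p * (toMat Λ (padOp Free (sandwich C Δ))).mulVec v p =
      (∑ q, v p * (sandwich C Δ (amb p) (amb q) * v q)) + (if Free (amb p) then 0 else v p ^ 2) := by
    intro p
    rw [mulVec_padOp]
    by_cases hp : Free (amb p)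
    · rw [if_pos hp, if_pos hp, add_zero, Finset.mul_sum]
      refine Finset.sum_congr rfl fun q _ => ?_
      by_cases hq : Free (amb q)
      · rw [if_pos hq]
      · rw [if_neg hq]
        -- non-free column: the sandwich entry vanishes (zero column of C)
        have h0 : sandwich C Δ (amb p) (amb q) = 0 := by
          rw [sandwich_eq_sum C Δ R (fun r hr => hR r p hr) (fun s hs => hR s q hs)]
          refine Finset.sum_eq_zero fun r _ => Finset.sum_eq_zero fun s _ => ?_
          rw [hC0 s (amb q) hq]; ring
        rw [h0]; ring
    · rw [if_neg hp, if_neg hp]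
      have h0 : ∀ q : B4.Idx Λ N, sandwich C Δ (amb p) (amb q) = 0 := by
        intro q
        rw [sandwich_eq_sum C Δ R (fun r hr => hR r p hr) (fun s hs => hR s q hs)]
        refine Finset.sum_eq_zero fun r _ => Finset.sum_eq_zero fun s _ => ?_
        rw [hC0 r (amb p) hp]; ring
      simp_rw [h0]
      simp [pow_two]
  rw [Finset.sum_congr rfl fun p _ => hrow p, Finset.sum_add_distrib]
  congr 1
  -- the free part: expand the sandwich and exchange the finite sums
  have hexp : ∀ p q : B4.Idx Λ N, v p * (sandwich C Δ (amb p) (amb q) * v q) =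
      ∑ r ∈ R, ∑ s ∈ R, (C r (amb p) * v p) * Δ r s * (C s (amb q) * v q) := by
    intro p q
    rw [sandwich_eq_sum C Δ R (fun r hr => hR r p hr) (fun s hs => hR s q hs), Finset.sum_mul, Finset.mul_sum]
    refine Finset.sum_congr rfl fun r _ => ?_
    rw [Finset.sum_mul, Finset.mul_sum]
    refine Finset.sum_congr rfl fun s _ => ?_
    ring
  have hrhs : ∀ r s : K d N, (∑ p, C r (amb p) * v p) * Δ r s * (∑ q, C s (amb q) * v q) =
      ∑ p : B4.Idx Λ N, ∑ q : B4.Idx Λ N, (C r (amb p) * v p) * Δ r s * (C s (amb q) * v q) := by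
    intro r s
    rw [Finset.sum_mul, Finset.sum_mul]
    refine Finset.sum_congr rfl fun p _ => ?_
    rw [Finset.mul_sum]
  calc ∑ p, ∑ q, v p * (sandwich C Δ (amb p) (amb q) * v q)
      = ∑ p, ∑ q, ∑ r ∈ R, ∑ s ∈ R, (C r (amb p) * v p) * Δ r s * (C s (amb q) * v q) :=
        Finset.sum_congr rfl fun p _ => Finset.sum_congr rfl fun q _ => hexp p q
    _ = ∑ p, ∑ r ∈ R, ∑ q, ∑ s ∈ R, (C r (amb p) * v p) * Δ r s * (C s (amb q) * v q) :=
        Finset.sum_congr rfl fun p _ => Finset.sum_comm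
    _ = ∑ r ∈ R, ∑ p, ∑ q, ∑ s ∈ R, (C r (amb p) * v p) * Δ r s * (C s (amb q) * v q) := Finset.sum_comm
    _ = ∑ r ∈ R, ∑ p, ∑ s ∈ R, ∑ q, (C r (amb p) * v p) * Δ r s * (C s (amb q) * v q) :=
        Finset.sum_congr rfl fun r _ => Finset.sum_congr rfl fun p _ => Finset.sum_comm
    _ = ∑ r ∈ R, ∑ s ∈ R, ∑ p, ∑ q, (C r (amb p) * v p) * Δ r s * (C s (amb q) * v q) :=
        Finset.sum_congr rfl fun r _ => Finset.sum_comm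
    _ = ∑ r ∈ R, ∑ s ∈ R, (∑ p, C r (amb p) * v p) * Δ r s * (∑ q, C s (amb q) * v q) :=
        Finset.sum_congr rfl fun r _ => Finset.sum_congr rfl fun s _ => (hrhs r s).symm

/-- **S4.a ⇒ (in5): the coercivity reduction.**  If the image `w = Cv` obeys a lower bound `γ·Σ_{r∈R} w_r² ≤ Σ_{r,s∈R} w_r Δ_{rs} w_s` and dominates the free
part of `v` (`Σ_{p free} v_p² ≤ Σ_{r∈R} w_r²`, PART 11 `elimZ_iso`-shape), and `0 ≤ γ ≤ 1`, then `γ·Σ_p v_p² ≤ ⟨v, (pad(CᵀΔC))_Λ v⟩` — the field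
`CovInputPad.hcoer` of the padded END socket. -/
theorem hcoer_of_lower (hC0 : ∀ r p, ¬ Free p → C r p = 0) (hR : ∀ r (p : B4.Idx Λ N), C r (amb p) ≠ 0 → r ∈ R)
    {γ : ℝ} (hγ0 : 0 ≤ γ) (hγ1 : γ ≤ 1) (v : B4.Idx Λ N → ℝ)
    (hlow : γ * ∑ r ∈ R, (∑ p, C r (amb p) * v p) ^ 2 ≤
      ∑ r ∈ R, ∑ s ∈ R, (∑ p, C r (amb p) * v p) * Δ r s * (∑ q, C s (amb q) * v q))
    (hiso : ∑ p, (if Free (amb p) then v p ^ 2 else 0) ≤ ∑ r ∈ R, (∑ p, C r (amb p) * v p) ^ 2) :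
    γ * ∑ p, v p ^ 2 ≤ ∑ p, v p * (toMat Λ (padOp Free (sandwich C Δ))).mulVec v p := by
  classical
  rw [quadForm_padOp_sandwich Free C Δ R hC0 hR v]
  have hsplit : ∑ p, v p ^ 2 = (∑ p, (if Free (amb p) then v p ^ 2 else 0)) + ∑ p, (if Free (amb p) then 0 else v p ^ 2) := by
    rw [← Finset.sum_add_distrib]
    refine Finset.sum_congr rfl fun p _ => ?_
    split_ifs <;> simp
  rw [hsplit, mul_add]
  have hnn : 0 ≤ ∑ p : B4.Idx Λ N, (if Free (amb p) then 0 else v p ^ 2) :=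
    Finset.sum_nonneg fun p _ => by split_ifs <;> positivity
  have h2 : γ * ∑ p : B4.Idx Λ N, (if Free (amb p) then 0 else v p ^ 2) ≤ ∑ p, (if Free (amb p) then 0 else v p ^ 2) := by
    nlinarith
  have h1 : γ * ∑ p, (if Free (amb p) then v p ^ 2 else 0) ≤
      ∑ r ∈ R, ∑ s ∈ R, (∑ p, C r (amb p) * v p) * Δ r s * (∑ q, C s (amb q) * v q) :=
    (mul_le_mul_of_nonneg_left hiso hγ0).trans hlow
  linarith

end QuadForm

end

end Summit.QuantumFields.BalabanUV.Beta.GAN24.DirichletExhaustionQuadForm
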